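import Literature.AlgebraicGeometry.Resolution.FiniteDeterminacy
import Mathlib.Analysis.Convex.Hull
import Mathlib.Analysis.Convex.Segment
import Mathlib.LinearAlgebra.AffineSpace.AffineSubspace.Defs
import Mathlib.LinearAlgebra.Dimension.Finrank
import Mathlib.MeasureTheory.Measure.Lebesgue.Basic
import Mathlib.MeasureTheory.Constructions.Pi
import Mathlib.RingTheory.Length
import Mathlib.RingTheory.IntegralClosure.IsIntegralClosure.Basic
import Mathlib.RingTheory.Localization.FractionRing
import Mathlib.RingTheory.Multiplicity
import Mathlib.Algebra.CharP.Defs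
import Mathlib.Data.Fin.VecNotation
import HarnessLib

/-!
# Newton non-degenerate singularities in arbitrary characteristic: Newton polyhedron, non-degeneracy
# notions (Kouchnirenko / Wall / Boubakri–Greuel–Markwig), Newton number, and the planar theorems
# (Kouchnirenko's theorem in any characteristic, Greuel–Nguyen's characterisation, Milnor's formula)

Topic: `Literature/AlgebraicGeometry/Resolution`. This file vendors §3 ("Non-degenerate singularities",
pp. 10–12) and §4 ("Invariants of plane curve singularities", pp. 13–16) of Y. Boubakri, G.-M. Greuel,
T. Markwig, *Invariants of hypersurface singularities in positive characteristic*, Rev. Mat. Complut. 25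
(2012) 61–85 = arXiv:1005.4503 [BoubakriGreuelMarkwig2010] — the two sections listed as "Not vendored" in
`FiniteDeterminacy.lean`, whose `jacobianIdeal`, `milnorNumber`, `IsIsolated` we reuse — together with
Def. 2.9 / Thm. 2.13 and §3 (a)–(f), Def. 3.2, Thm. 3.12 of G.-M. Greuel, Nguyen Hong Duc, *Some remarks on
the planar Kouchnirenko's theorem*, Rev. Mat. Complut. 25 (2012) 557–579 = arXiv:1009.4889
[GreuelNguyen2010]. Page / theorem numbers are those of the arXiv texts.

Standing conventions ([BoubakriGreuelMarkwig2010] §1 p. 3, §3 p. 10): `K` an algebraically closed field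
of arbitrary characteristic, `K[[x]] = K[[x₁,…,xₙ]]`; §4 and [GreuelNguyen2010]: `n = 2`,
`0 ≠ f ∈ 𝔪 = ⟨x,y⟩`. The definitions below are stated for any field `K`; the NAMED FACTS quantify over
algebraically closed `K` as printed.

## Rendering of "face of the Newton diagram"

Printed (§3 p. 10): `Γ₊(f)` = convex hull of `⋃_{α ∈ supp f} (α + ℝⁿ_{≥0})`; the Newton diagram `Γ(f)`
= the union of the COMPACT faces of `Γ₊(f)`; `Γ₋(f)` = the union of the segments joining the origin to
the points of `Γ(f)`; `f` is convenient iff `Γ(f)` meets every coordinate axis; for a face `Δ`,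
`In_Δ(f) = Σ_{α ∈ Δ} a_α x^α`. We render "compact face of `Γ₊(f)`" as "face of `Γ₊(f)` exposed by a
linear functional `x ↦ Σ wᵢ xᵢ` with ALL `wᵢ > 0`" (`face w f`): for the Newton polyhedron of a power
series these are exactly the compact faces (a face is bounded iff it is cut out by a strictly positive
weight; this is Kouchnirenko's own weight filtration language, [Kou76] via [BoubakriGreuelMarkwig2010]
Remark 3.2), every compact face of every dimension — vertices included — arises this way, and
`In_Δ(f)` depends only on `Δ`. Consequently "for each face `Δ` of `Γ(f)`" is rendered "for every
`w ∈ (ℝ_{>0})ⁿ`". `In_w(f)` is typed as the power series keeping the coefficients of `f` at the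
exponents of minimal `w`-weight (a finite set for `w > 0`); polynomial functions of it are evaluated at
points `q ∈ Kⁿ` by a finitely supported sum (`evalAt`; junk `0` on infinite support, which does not occur
for `w > 0`).

NOT typed (prose only): Wall's general `C`-polytopes `P` and "`f` is INND :⇔ ∃ `C`-polytope `P` such that
`f` is IND along every inner face of `P` and `supp f` has no point below `P`" ([BoubakriGreuelMarkwig2010]
§3 p. 10; [Wal99]); we type inner non-degeneracy only w.r.t. `P = Γ(f)` (`IsInnerNondegenerateAlong`,
`IsINNDDiagram`; "`Γ(f)` is a `C`-polytope iff `f` is convenient", p. 10), which is the instance used in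
Prop. 4.3 and in [GreuelNguyen2010] Thm. 2.13 (ii); accordingly Thm. 3.5 (INND ⇒ `μ = μ_N`) and the
clause (iii) of Thm. 2.13 are not vendored. Kouchnirenko's and Wall's original papers ([Kou76]
doi:10.1007/bf01389769, [Wal99] J. reine angew. Math. 509) are cited through [BoubakriGreuelMarkwig2010].

## Content

* `newtonPolyhedron f = Γ₊(f)`, `face w f`, `newtonDiagram f = Γ(f)`, `below f = Γ₋(f)`,
  `IsConvenient f` (§3 p. 10); `initialForm w f = In_Δ(f)`; `IsNondegenerateAlong` (ND: `j(In_Δ f)`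
  has no zero in the torus `(K*)ⁿ`), `IsNewtonNondegenerate` (NND: ND along each face of `Γ(f)`, `f` not
  required convenient), `IsInnerFace`, `coordSpace q = H_q`, `IsInnerNondegenerateAlong` (IND),
  `IsINNDDiagram` (INND w.r.t. `Γ(f)`), `IsWeaklyNondegenerateAlong` (WND: `tj(In_Δ f)` has no zero in
  the torus), `IsFacet`, `IsWeaklyNewtonNondegenerate` (WNND: WND along each facet) (§3 p. 10).
* `coordVolume k Q = V_k(Q)` (sum of the `k`-dimensional volumes of the intersections of `Q` with the
  `k`-dimensional coordinate subspaces), `newtonNumberOfSet Q = μ_N(Q) = Σ_k (−1)^{n−k} k! V_k(Q)`,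
  `perturb f m = f_m = f + x₁^m + … + xₙ^m`, `newtonNumber f = μ_N(f) = sup_m μ_N(Γ₋(f_m)) ∈ ℕ ∪ {∞}`
  (§3 p. 11; the printed values `μ_N(Γ₋(f_m))` are non-negative integers for the convenient `f_m`
  (Kouchnirenko), we pass through `⌊·⌋₊`), `milnorNumberENat f = μ(f) ∈ ℕ ∪ {∞}`.
* Planar (`n = 2`, `x = X 0`, `y = X 1`): `latticeLength Δ = l(Δ)`, `facets f`, `rN f = r_N(f)`,
  `numBranches f = r(f)` ("number of branches counted with multiplicity", as the sum of the
  multiplicities of the irreducible factors), `deltaInvariant f = δ(f) = dim_K(R̄/R)`, `R = K[[x,y]]/⟨f⟩`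
  ([GreuelNguyen2010] §3 (a); typed as the `R`-length of `R̄/R`, which equals the `K`-dimension since
  `R/𝔪_R = K`), `deltaN f = δ_N(f)` (§4 p. 14: `V₂(Γ₋) − V₁(Γ₋)/2 + Σ l(Δᵢ)/2` for convenient `f`, `sup`
  over `f_m` otherwise), `IsND1AtAxisVertex`, `IsNND1` ([GreuelNguyen2010] Def. 2.9),
  `IsWHNondegenerateAlong` / `IsWHNND` ([GreuelNguyen2010] Def. 3.2 via Lemma 3.3).
* NAMED FACTS (not proved here): `Thm33` (Kouchnirenko's theorem in arbitrary characteristic,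
  [BoubakriGreuelMarkwig2010] Thm. 3.3), `Prop43` (planar: NND ⇒ INND w.r.t. `Γ(f)`), `Prop45` (planar:
  NND ⇒ `μ(f) = μ_N(f)`, no convenience needed), `GNThm213` ([GreuelNguyen2010] Thm. 2.13 (i)⇔(ii)),
  `Thm413` (Milnor's formula `μ = 2δ − r + 1` for planar NND `f`, any characteristic), `Prop414`
  (Deligne, Melle–Wall: `μ ≥ 2δ − r + 1`), `Prop416` (`μ − μ_N ≥ r_N − r ≥ 0`), `GNThm312`
  ([GreuelNguyen2010] Thm. 3.12: `δ = δ_N ⟺` WHNND, `f` reduced), `GBPThm31` (E. R. García Barroso,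
  A. Płoski, *A note on the plane curve singularities in positive characteristic*, arXiv:2207.14523
  [GarciaBarrosoPloski2022], Thm. 3.1: `μ̄ − μ(N_f) ≥ r(N_f) − r ≥ 0`, with equality for (weakly =
  Bernstein–Płoski) non-degenerate reduced `f`). Statements involving `μ`, `δ`, `μ_N`, `δ_N` are read in
  `ℕ ∪ {∞}` and rendered without subtraction.
* Two printed EXAMPLES as named facts (their `μ` values are computations of the papers, not re-done
  here): `Ex46` (`char K = 2`, `f = x⁶ + y³ + x⁵y`: `μ = 13 > 10 = μ_N`), `GNEx21` (`char K = 3`,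
  `f = x³ + xy + y³`: `μ = μ_N = 1` but `f` not NND).

Used by the RESOLUTION OBSERVATORY cell (`Summits/ResolutionOfSingularities`, unit pub-rosobs-carver-g12)
as the source of truth for the census columns ND / NND / IND / WND / WNND / ND1 / NND1 / WHNND / `μ_N` /
`δ_N` / `r_N` read on blow-up trees of `x^p + F(y,z)`; no statement of this file is specific to that use.
-/

noncomputable section

open scoped ENNReal
open MeasureTheory IsLocalRing

namespace Literature.AlgebraicGeometry.Resolution

namespace BoubakriGreuelMarkwig

variable {K : Type*} [Field K] {n : ℕ}

/-! ### Newton polyhedron, compact faces, Newton diagram ([BoubakriGreuelMarkwig2010] §3 p. 10) -/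

/-- The support `supp(f) = {α | a_α ≠ 0}` of `f = Σ a_α x^α`. [cite: BoubakriGreuelMarkwig2010, §3 (p. 10)] -/
def supp (f : MvPowerSeries (Fin n) K) : Set (Fin n →₀ ℕ) :=
  {α | MvPowerSeries.coeff α f ≠ 0}

/-- An exponent `α ∈ ℕⁿ` as a point of `ℝⁿ`. [folklore] -/
def expPt (α : Fin n →₀ ℕ) : Fin n → ℝ := fun i => (α i : ℝ)

/-- The **Newton polyhedron** `Γ₊(f)`: the convex hull of `⋃_{α ∈ supp f} (α + ℝⁿ_{≥0})`.
[cite: BoubakriGreuelMarkwig2010, §3 (p. 10)] -/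
def newtonPolyhedron (f : MvPowerSeries (Fin n) K) : Set (Fin n → ℝ) :=
  convexHull ℝ (⋃ α ∈ supp f, {x : Fin n → ℝ | ∀ i, (α i : ℝ) ≤ x i})

/-- The linear functional `x ↦ Σᵢ wᵢ xᵢ` of a weight vector `w`. [folklore] -/
def pairing (w x : Fin n → ℝ) : ℝ := ∑ i, w i * x i

/-- The face of `Γ₊(f)` exposed by the weight `w`: the points of `Γ₊(f)` minimising `Σ wᵢ xᵢ`. For
`w ∈ (ℝ_{>0})ⁿ` these are exactly the compact faces of `Γ₊(f)` (all dimensions, vertices included); see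
the module docstring. [cite: BoubakriGreuelMarkwig2010, §3 (p. 10)] -/
def face (w : Fin n → ℝ) (f : MvPowerSeries (Fin n) K) : Set (Fin n → ℝ) :=
  {x | x ∈ newtonPolyhedron f ∧ ∀ y ∈ newtonPolyhedron f, pairing w x ≤ pairing w y}

/-- The **Newton diagram** `Γ(f)`: the union of the compact faces of `Γ₊(f)` ("following the convention
of Arnol'd"; the Newton polygon if `n = 2`). [cite: BoubakriGreuelMarkwig2010, §3 (p. 10)] -/
def newtonDiagram (f : MvPowerSeries (Fin n) K) : Set (Fin n → ℝ) :=
  ⋃ (w : Fin n → ℝ) (_ : ∀ i, 0 < w i), face w f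

/-- `Γ₋(f)`: "the union of all line segments joining the origin to a point on `Γ(f)`".
[cite: BoubakriGreuelMarkwig2010, §3 (p. 10)] -/
def below (f : MvPowerSeries (Fin n) K) : Set (Fin n → ℝ) :=
  ⋃ x ∈ newtonDiagram f, segment ℝ 0 x

/-- `f` is **convenient**: "the Newton diagram of `f` meets all coordinate axes".
[cite: BoubakriGreuelMarkwig2010, §3 (p. 10)] -/
def IsConvenient (f : MvPowerSeries (Fin n) K) : Prop :=
  ∀ i : Fin n, ∃ x ∈ newtonDiagram f, ∀ j, j ≠ i → x j = 0

/-! ### Initial forms and the non-degeneracy notions ([BoubakriGreuelMarkwig2010] §3 p. 10) -/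

/-- The `w`-weight `Σ wᵢ αᵢ` of an exponent. [folklore] -/
def wdeg (w : Fin n → ℝ) (α : Fin n →₀ ℕ) : ℝ := pairing w (expPt α)

/-- The **initial form (principal part)** `In_Δ(f) = Σ_{α ∈ Δ} a_α x^α` of `f` along the face
`Δ = face w f` (`w ∈ (ℝ_{>0})ⁿ`): the power series keeping exactly the coefficients of `f` at the
exponents of minimal `w`-weight among `supp f` (a finite set when all `wᵢ > 0`).
[cite: BoubakriGreuelMarkwig2010, §3 (p. 10)] -/
def initialForm (w : Fin n → ℝ) (f : MvPowerSeries (Fin n) K) : MvPowerSeries (Fin n) K :=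
  fun α => open Classical in if α ∈ supp f ∧ ∀ β ∈ supp f, wdeg w α ≤ wdeg w β then MvPowerSeries.coeff α f else 0

/-- Evaluation of a finitely supported power series (a polynomial such as `In_Δ(f)` or its partial
derivatives) at a point `q ∈ Kⁿ`: `Σ_α a_α q^α` (a `finsum`; junk value `0` if the support is infinite,
which does not happen for the initial forms along compact faces). [folklore] -/
def evalAt (g : MvPowerSeries (Fin n) K) (q : Fin n → K) : K :=
  ∑ᶠ α : Fin n →₀ ℕ, MvPowerSeries.coeff α g * ∏ i, q i ^ (α i)

/-- `q ∈ Kⁿ` is a zero of the Jacobian ideal `j(g) = ⟨∂g/∂x₁,…,∂g/∂xₙ⟩` of the polynomial `g`.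
[cite: BoubakriGreuelMarkwig2010, §3 (p. 10)] -/
def IsJacobianZero (g : MvPowerSeries (Fin n) K) (q : Fin n → K) : Prop :=
  ∀ i : Fin n, evalAt (MvPowerSeries.pderiv i g) q = 0

/-- `q ∈ Kⁿ` is a zero of the Tjurina ideal `tj(g) = ⟨g, ∂g/∂x₁,…,∂g/∂xₙ⟩` of the polynomial `g`.
[cite: BoubakriGreuelMarkwig2010, §3 (p. 10)] -/
def IsTjurinaZero (g : MvPowerSeries (Fin n) K) (q : Fin n → K) : Prop :=
  evalAt g q = 0 ∧ IsJacobianZero g q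

/-- `q` lies in the torus `(K*)ⁿ`. [cite: BoubakriGreuelMarkwig2010, §3 (p. 10)] -/
def InTorus (q : Fin n → K) : Prop := ∀ i, q i ≠ 0

/-- **ND** — `f` is **non-degenerate along** the face `Δ = face w f` ("following Wall"): the Jacobian
ideal `j(In_Δ(f))` has no zero in the torus `(K*)ⁿ` (equivalently, Remark 3.2 [Kou76]: the
`xᵢ · ∂In_Δ(f)/∂xᵢ` have no common zero in the torus). [cite: BoubakriGreuelMarkwig2010, §3 (p. 10)] -/
def IsNondegenerateAlong (w : Fin n → ℝ) (f : MvPowerSeries (Fin n) K) : Prop :=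
  ∀ q : Fin n → K, InTorus q → ¬ IsJacobianZero (initialForm w f) q

/-- **NND** — `f` is **Newton non-degenerate**: non-degenerate along each face (of any dimension) of the
Newton diagram `Γ(f)`; "unlike Wall we do not require `f` to be convenient".
[cite: BoubakriGreuelMarkwig2010, §3 (p. 10)] -/
def IsNewtonNondegenerate (f : MvPowerSeries (Fin n) K) : Prop :=
  ∀ w : Fin n → ℝ, (∀ i, 0 < w i) → IsNondegenerateAlong w f

/-- `Δ` is an **inner face**: "not contained in any coordinate hyperplane".
[cite: BoubakriGreuelMarkwig2010, §3 (p. 10)] -/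
def IsInnerFace (Δ : Set (Fin n → ℝ)) : Prop :=
  ∀ i : Fin n, ¬ (Δ ⊆ {x | x i = 0})

/-- The coordinate subspace `H_q = ⋂_{qᵢ = 0} {xᵢ = 0} ⊆ ℝⁿ` determined by a point `q ∈ Kⁿ`.
[cite: BoubakriGreuelMarkwig2010, §3 (p. 10)] -/
def coordSpace (q : Fin n → K) : Set (Fin n → ℝ) :=
  {x | ∀ i, q i = 0 → x i = 0}

/-- **IND** — `f` is **inner non-degenerate along** `Δ = face w f`: "for each zero `q` of the Jacobian
ideal `j(In_Δ(f))` the polytope `Δ` contains no point on `H_q`".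
[cite: BoubakriGreuelMarkwig2010, §3 (p. 10)] -/
def IsInnerNondegenerateAlong (w : Fin n → ℝ) (f : MvPowerSeries (Fin n) K) : Prop :=
  ∀ q : Fin n → K, IsJacobianZero (initialForm w f) q → Disjoint (face w f) (coordSpace q)

/-- **INND w.r.t. `Γ(f)`** (the instance `P = Γ(f)` of Wall's notion, meaningful for convenient `f`,
for which `Γ(f)` is a `C`-polytope and no point of `supp f` lies below it): `f` is inner non-degenerate
along each inner face of `Γ(f)`. The general notion "INND :⇔ INND w.r.t. SOME `C`-polytope" is not typed
(module docstring). [cite: BoubakriGreuelMarkwig2010, §3 (p. 10)] -/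
def IsINNDDiagram (f : MvPowerSeries (Fin n) K) : Prop :=
  IsConvenient f ∧
    ∀ w : Fin n → ℝ, (∀ i, 0 < w i) → IsInnerFace (face w f) → IsInnerNondegenerateAlong w f

/-- **WND** — `f` is **weakly non-degenerate along** `Δ = face w f`: the Tjurina ideal `tj(In_Δ(f))`
has no zero in the torus `(K*)ⁿ`. [cite: BoubakriGreuelMarkwig2010, §3 (p. 10)] -/
def IsWeaklyNondegenerateAlong (w : Fin n → ℝ) (f : MvPowerSeries (Fin n) K) : Prop :=
  ∀ q : Fin n → K, InTorus q → ¬ IsTjurinaZero (initialForm w f) q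

/-- `face w f` is a **facet** of `Γ(f)`: a top-dimensional (i.e. `(n−1)`-dimensional) compact face.
[cite: BoubakriGreuelMarkwig2010, §3 (p. 10)] -/
def IsFacet (w : Fin n → ℝ) (f : MvPowerSeries (Fin n) K) : Prop :=
  Module.finrank ℝ (vectorSpan ℝ (face w f)) = n - 1

/-- **WNND** — `f` is **weakly Newton non-degenerate**: weakly non-degenerate along each facet of
`Γ(f)`. [cite: BoubakriGreuelMarkwig2010, §3 (p. 10)] -/
def IsWeaklyNewtonNondegenerate (f : MvPowerSeries (Fin n) K) : Prop :=
  ∀ w : Fin n → ℝ, (∀ i, 0 < w i) → IsFacet w f → IsWeaklyNondegenerateAlong w f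

/-! ### Newton number ([BoubakriGreuelMarkwig2010] §3 p. 11) -/

/-- Embed `ℝ^S` as the coordinate subspace of `ℝⁿ` spanned by the axes in `S` (other coordinates `0`).
[folklore] -/
def coordEmbed (S : Finset (Fin n)) (y : S → ℝ) : Fin n → ℝ :=
  fun i => if h : i ∈ S then y ⟨i, h⟩ else 0

/-- `V_k(Q)`: "the sum of the `k`-dimensional Euclidean volumes of the intersections of `Q` with the
`k`-dimensional coordinate subspaces of `ℝⁿ`" (Lebesgue measure of `ℝ^S`, `|S| = k`; for `k = 0` the
value is `1` if `0 ∈ Q` and `0` otherwise). [cite: BoubakriGreuelMarkwig2010, §3 (p. 11)] -/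
def coordVolume (k : ℕ) (Q : Set (Fin n → ℝ)) : ℝ≥0∞ :=
  ∑ S ∈ (Finset.univ : Finset (Fin n)).powersetCard k, volume {y : S → ℝ | coordEmbed S y ∈ Q}

/-- The **Newton number of a compact polytope** `Q ⊆ ℝⁿ_{≥0}`:
`μ_N(Q) = Σ_{k=0}^{n} (−1)^{n−k} · k! · V_k(Q)` (Kouchnirenko). [cite: BoubakriGreuelMarkwig2010, §3 (p. 11)] -/
def newtonNumberOfSet (Q : Set (Fin n → ℝ)) : ℝ :=
  ∑ k ∈ Finset.range (n + 1), (-1 : ℝ) ^ (n - k) * (k.factorial : ℝ) * (coordVolume k Q).toReal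

/-- `f_m = f + x₁^m + … + xₙ^m`. [cite: BoubakriGreuelMarkwig2010, §3 (p. 11)] -/
def perturb (f : MvPowerSeries (Fin n) K) (m : ℕ) : MvPowerSeries (Fin n) K :=
  f + ∑ i : Fin n, MvPowerSeries.X i ^ m

/-- The **Newton number** of a power series:
`μ_N(f) = sup { μ_N(Γ₋(f_m)) | f_m = f + x₁^m + … + xₙ^m, m ≥ 1 } ∈ ℕ ∪ {∞}`; "if `f` is convenient
then `μ_N(f) = μ_N(Γ₋(f))`". The printed `μ_N(Γ₋(f_m))` are non-negative integers (the `f_m` are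
convenient); the real number `newtonNumberOfSet` is passed through `⌊·⌋₊`.
[cite: BoubakriGreuelMarkwig2010, §3 (p. 11)] -/
def newtonNumber (f : MvPowerSeries (Fin n) K) : ℕ∞ :=
  ⨆ (m : ℕ) (_ : 1 ≤ m), ((⌊newtonNumberOfSet (below (perturb f m))⌋₊ : ℕ) : ℕ∞)

open Classical in
/-- The Milnor number as an element of `ℕ ∪ {∞}`: `μ(f)` if `μ(f) < ∞` (`IsIsolated f`), else `∞`.
[cite: BoubakriGreuelMarkwig2010, §1 (p. 3)] -/
def milnorNumberENat (f : MvPowerSeries (Fin n) K) : ℕ∞ :=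
  if IsIsolated f then (milnorNumber f : ℕ∞) else ⊤

/-! ### Planar invariants ([BoubakriGreuelMarkwig2010] §4 Remark 4.1 p. 13, p. 14; [GreuelNguyen2010] §3) -/

/-- The exponent `(a, b)` of `x^a y^b` (`x = X 0`, `y = X 1`). [folklore] -/
def e2 (a b : ℕ) : Fin 2 →₀ ℕ := Finsupp.single 0 a + Finsupp.single 1 b

/-- The **lattice length** `l(Δ)` of a facet: "the number of lattice points on `Δ` minus one".
[cite: BoubakriGreuelMarkwig2010, Rem. 4.1 (p. 13)] -/
def latticeLength (Δ : Set (Fin n → ℝ)) : ℕ :=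
  (Δ ∩ Set.range (expPt (n := n))).ncard - 1

/-- The set of facets `Δ₁, …, Δ_k` of the Newton diagram `Γ(f)`. [cite: BoubakriGreuelMarkwig2010, Rem. 4.1 (p. 13)] -/
def facets (f : MvPowerSeries (Fin n) K) : Set (Set (Fin n → ℝ)) :=
  {Δ | ∃ w : Fin n → ℝ, (∀ i, 0 < w i) ∧ IsFacet w f ∧ Δ = face w f}

/-- `max { j | xᵢ^j divides f }` (= the least `i`-th exponent occurring in `supp f`; junk `0` at `f = 0`).
[cite: BoubakriGreuelMarkwig2010, Rem. 4.1 (p. 13)] -/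
def maxPow (i : Fin n) (f : MvPowerSeries (Fin n) K) : ℕ :=
  sInf {k | ∃ α ∈ supp f, α i = k}

/-- `r_N(f) = Σᵢ l(Δᵢ) + max{j | x^j divides f} + max{l | y^l divides f}`.
[cite: BoubakriGreuelMarkwig2010, Rem. 4.1 (p. 13)] -/
def rN (f : MvPowerSeries (Fin 2) K) : ℕ :=
  (∑ᶠ Δ ∈ facets f, latticeLength Δ) + maxPow 0 f + maxPow 1 f

/-- `r(f)`: "the number of branches of `f` counted with multiplicity" — the sum, over the classes of
irreducible power series `g` up to units, of the multiplicity of `g` in `f` (`K[[x,y]]` is factorial).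
[cite: BoubakriGreuelMarkwig2010, Rem. 4.1 (p. 13)] -/
def numBranches (f : MvPowerSeries (Fin 2) K) : ℕ :=
  open Classical in
  ∑ᶠ c : Associates (MvPowerSeries (Fin 2) K), if Irreducible c then multiplicity c (Associates.mk f) else 0

/-- The **delta invariant** `δ(f) = dim_K(R̄/R)`, `R = K[[x,y]]/⟨f⟩`, `R̄` the integral closure of `R` in
its total ring of fractions ([GreuelNguyen2010] §3 (a); equal to `Σ_{Q→0} m_Q(m_Q−1)/2`,
[BoubakriGreuelMarkwig2010] Rem. 4.1). Typed as the `R`-length of `R̄/R` (`= dim_K` because the residue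
field of `R` is `K`), in `ℕ ∪ {∞}`. [cite: GreuelNguyen2010, §3 (a) (p. 9)] -/
def deltaInvariant (f : MvPowerSeries (Fin 2) K) : ℕ∞ :=
  let R := MvPowerSeries (Fin 2) K ⧸ Ideal.span {f}
  Module.length R
    (↥(integralClosure R (Localization (nonZeroDivisors R))) ⧸
      LinearMap.range (Algebra.linearMap R ↥(integralClosure R (Localization (nonZeroDivisors R)))))

/-- `δ_N` of a CONVENIENT planar `f` with facets `Δ₁,…,Δ_k`:
`δ_N(f) = V₂(Γ₋(f)) − V₁(Γ₋(f))/2 + Σᵢ l(Δᵢ)/2` (a non-negative integer by Pick's formula; we pass the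
real number through `⌊·⌋₊`). [cite: BoubakriGreuelMarkwig2010, §4 (p. 14)] -/
def deltaNConvenient (f : MvPowerSeries (Fin 2) K) : ℕ :=
  ⌊(coordVolume 2 (below f)).toReal - (coordVolume 1 (below f)).toReal / 2 +
      ((∑ᶠ Δ ∈ facets f, latticeLength Δ : ℕ) : ℝ) / 2⌋₊

/-- `δ_N(f) = sup { δ_N(f_m) | f_m = f + x^m + y^m, m ∈ ℕ }` for non-convenient `f` (and `= δ_N(f)` of
`deltaNConvenient` when `f` is convenient, the values stabilising — Example 4.7 / Lemma 4.8), in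
`ℕ ∪ {∞}`. [cite: BoubakriGreuelMarkwig2010, §4 (p. 14)] -/
def deltaN (f : MvPowerSeries (Fin 2) K) : ℕ∞ :=
  ⨆ (m : ℕ) (_ : 1 ≤ m), ((deltaNConvenient (perturb f m) : ℕ) : ℕ∞)

/-- **ND1 at the axis vertices** ([GreuelNguyen2010] Def. 2.9), for the variable `xᵢ` (`i = 1`: the
vertex `(0, n)` on the `y`-axis; `i = 0`: the vertex `(m, 0)` on the `x`-axis): with `(0,n)` the vertex of
`Γ(f)` on the `y`-axis and `(1, j₁)` the intersection point of `Γ(f)` with the line `x = 1`, "`f` is ND1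
along `(0,n)` if either `char(K) = p = 0` or if `p ≠ 0` then `p ∤ n` or `j₁ ∈ ℕ` and the coefficient
`c_{1 j₁}` of `x y^{j₁}` in `f` is different from zero"; analogously at `(m, 0)`. (Vacuous if `Γ(f)` has
no vertex on that axis.) [cite: GreuelNguyen2010, Def. 2.9 (p. 5)] -/
def IsND1AtAxisVertex (i : Fin 2) (f : MvPowerSeries (Fin 2) K) : Prop :=
  let o : Fin 2 := if i = 0 then 1 else 0   -- the other variable
  let ex : ℕ → ℕ → (Fin 2 →₀ ℕ) := fun a b => Finsupp.single i a + Finsupp.single o b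
  ∀ N : ℕ, (MvPowerSeries.coeff (ex N 0) f ≠ 0 ∧ ∀ N' < N, MvPowerSeries.coeff (ex N' 0) f = 0) →
    (ringChar K = 0 ∨ ¬ (ringChar K ∣ N) ∨
      ∃ j : ℕ, expPt (ex j 1) ∈ newtonDiagram f ∧ MvPowerSeries.coeff (ex j 1) f ≠ 0)

/-- **NND1** ([GreuelNguyen2010] Def. 2.9): "`f` is called NND1 if `f` is convenient, ND along each inner
face and ND1 along each vertex on the axes of `Γ(f)`". [cite: GreuelNguyen2010, Def. 2.9 (p. 5)] -/
def IsNND1 (f : MvPowerSeries (Fin 2) K) : Prop :=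
  IsConvenient f ∧
    (∀ w : Fin 2 → ℝ, (∀ i, 0 < w i) → IsInnerFace (face w f) → IsNondegenerateAlong w f) ∧
    IsND1AtAxisVertex 0 f ∧ IsND1AtAxisVertex 1 f

/-- The `w`-weighted homogeneous part of `f` of weight `d` (for `w ∈ ℕ²`), as a power series.
[cite: GreuelNguyen2010, §3 (p. 9)] -/
def weightedPart (w : Fin 2 → ℕ) (d : ℕ) (f : MvPowerSeries (Fin 2) K) : MvPowerSeries (Fin 2) K :=
  fun α => if w 0 * α 0 + w 1 * α 1 = d then MvPowerSeries.coeff α f else 0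

/-- **WHNND** ([GreuelNguyen2010] Def. 3.2, in the equivalent form of Lemma 3.3): `f` is NOT weighted
homogeneous Newton non-degenerate iff there exist `a, b ∈ K*` and coprime `m, n ∈ ℕ_{>0}` such that the
first term `f^w_d` of the `(n,m)`-weighted decomposition of `f` is divisible by `(a x^m − b y^n)²` and the
second term `f^w_{d+1}` is divisible by `(a x^m − b y^n)`. [cite: GreuelNguyen2010, Def. 3.2 / Lemma 3.3 (p. 9)] -/
def IsWHNND (f : MvPowerSeries (Fin 2) K) : Prop :=
  ¬ ∃ (a b : K) (m k : ℕ), a ≠ 0 ∧ b ≠ 0 ∧ 0 < m ∧ 0 < k ∧ Nat.Coprime m k ∧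
      ∃ d : ℕ, (∀ d' < d, weightedPart ![k, m] d' f = 0) ∧ weightedPart ![k, m] d f ≠ 0 ∧
        let ℓ : MvPowerSeries (Fin 2) K :=
          MvPowerSeries.C a * MvPowerSeries.X 0 ^ m - MvPowerSeries.C b * MvPowerSeries.X 1 ^ k
        ℓ ^ 2 ∣ weightedPart ![k, m] d f ∧ ℓ ∣ weightedPart ![k, m] (d + 1) f

/-! ### Named facts -/

/-- **Kouchnirenko's theorem in arbitrary characteristic** ([BoubakriGreuelMarkwig2010] Thm. 3.3,
[Kou76]): for `f ∈ K[[x₁,…,xₙ]]` (`K` algebraically closed of any characteristic, `n ≥ 2`, `f ∈ 𝔪`)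
`μ_N(f) ≤ μ(f)`, and if `f` is NND and convenient then `μ(f) = μ_N(f) < ∞`. Named fact, not proved here.
[cite: BoubakriGreuelMarkwig2010, Thm. 3.3] -/
def Thm33 : Prop :=
  ∀ (K : Type) [Field K] [IsAlgClosed K] (n : ℕ), 2 ≤ n →
    ∀ f : MvPowerSeries (Fin n) K, f ∈ maximalIdeal (MvPowerSeries (Fin n) K) →
      newtonNumber f ≤ milnorNumberENat f ∧
      (IsNewtonNondegenerate f → IsConvenient f →
        IsIsolated f ∧ (milnorNumber f : ℕ∞) = newtonNumber f)

/-- [BoubakriGreuelMarkwig2010] **Proposition 4.3** (planar): if `0 ≠ f ∈ ⟨x,y⟩ ⊆ K[[x,y]]` is NND then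
`f` is INND w.r.t. `Γ(f)`, i.e. IND along each inner face of `Γ(f)`. Named fact, not proved here.
[cite: BoubakriGreuelMarkwig2010, Prop. 4.3] -/
def Prop43 : Prop :=
  ∀ (K : Type) [Field K] [IsAlgClosed K] (f : MvPowerSeries (Fin 2) K), f ≠ 0 →
    f ∈ maximalIdeal (MvPowerSeries (Fin 2) K) → IsNewtonNondegenerate f →
      ∀ w : Fin 2 → ℝ, (∀ i, 0 < w i) → IsInnerFace (face w f) → IsInnerNondegenerateAlong w f

/-- [BoubakriGreuelMarkwig2010] **Proposition 4.5** (planar Kouchnirenko without convenience, any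
characteristic): if `0 ≠ f ∈ ⟨x,y⟩ ⊆ K[[x,y]]` is NND then `μ(f) = μ_N(f)` (in `ℕ ∪ {∞}`).
Named fact, not proved here. [cite: BoubakriGreuelMarkwig2010, Prop. 4.5] -/
def Prop45 : Prop :=
  ∀ (K : Type) [Field K] [IsAlgClosed K] (f : MvPowerSeries (Fin 2) K), f ≠ 0 →
    f ∈ maximalIdeal (MvPowerSeries (Fin 2) K) → IsNewtonNondegenerate f →
      milnorNumberENat f = newtonNumber f

/-- [GreuelNguyen2010] **Theorem 2.13, (i) ⇔ (ii)** (planar, `K` algebraically closed of any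
characteristic, `f ∈ 𝔪 ⊆ K[[x,y]]`, `f_m = f + x^m + y^m`): `μ(f) = μ_N(f) < ∞` iff `μ(f) < ∞` and `f_m`
is NND1 for (some, equivalently — by the printed proof — all sufficiently) large `m`; rendered with
"for arbitrarily large `m`". Clause (iii) "`f` is INND" is not vendored (module docstring).
Named fact, not proved here. [cite: GreuelNguyen2010, Thm. 2.13] -/
def GNThm213 : Prop :=
  ∀ (K : Type) [Field K] [IsAlgClosed K] (f : MvPowerSeries (Fin 2) K),
    f ∈ maximalIdeal (MvPowerSeries (Fin 2) K) →
      ((IsIsolated f ∧ (milnorNumber f : ℕ∞) = newtonNumber f) ↔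
        (IsIsolated f ∧ ∀ M : ℕ, ∃ m : ℕ, M < m ∧ IsNND1 (perturb f m)))

/-- [BoubakriGreuelMarkwig2010] **Theorem 4.13 (Milnor's formula in arbitrary characteristic for NND
singularities)**: if `0 ≠ f ∈ ⟨x,y⟩ ⊆ K[[x,y]]` is NND then `μ(f) = 2·δ(f) − r(f) + 1`. Read in
`ℕ ∪ {∞}` (both sides are infinite for a non-reduced NND `f` such as `x²y`) and rendered without
subtraction as `μ(f) + r(f) = 2·δ(f) + 1`. Named fact, not proved here.
[cite: BoubakriGreuelMarkwig2010, Thm. 4.13] -/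
def Thm413 : Prop :=
  ∀ (K : Type) [Field K] [IsAlgClosed K] (f : MvPowerSeries (Fin 2) K), f ≠ 0 →
    f ∈ maximalIdeal (MvPowerSeries (Fin 2) K) → IsNewtonNondegenerate f →
      milnorNumberENat f + (numBranches f : ℕ∞) = 2 * deltaInvariant f + 1

/-- [BoubakriGreuelMarkwig2010] **Proposition 4.14 (Deligne, Melle–Wall)**: for `0 ≠ f ∈ ⟨x,y⟩ ⊆
K[[x,y]]`, `μ(f) ≥ 2·δ(f) − r(f) + 1` (the difference counts the wild vanishing cycles). Read in
`ℕ ∪ {∞}` and rendered without subtraction as `2·δ(f) + 1 ≤ μ(f) + r(f)` (trivial when `μ(f) = ∞`;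
`μ(f) < ∞` forces `f` reduced, hence `δ(f) < ∞`). Named fact, not proved here.
[cite: BoubakriGreuelMarkwig2010, Prop. 4.14] -/
def Prop414 : Prop :=
  ∀ (K : Type) [Field K] [IsAlgClosed K] (f : MvPowerSeries (Fin 2) K), f ≠ 0 →
    f ∈ maximalIdeal (MvPowerSeries (Fin 2) K) →
      2 * deltaInvariant f + 1 ≤ milnorNumberENat f + (numBranches f : ℕ∞)

/-- [BoubakriGreuelMarkwig2010] **Proposition 4.16**: for `0 ≠ f ∈ ⟨x,y⟩ ⊆ K[[x,y]]`,
`μ(f) − μ_N(f) ≥ r_N(f) − r(f) ≥ 0`. Read in `ℕ ∪ {∞}` (`μ_N(f) ≤ μ(f)` by Thm. 3.3) and rendered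
without subtraction as `r(f) ≤ r_N(f)` and `μ_N(f) + r_N(f) ≤ μ(f) + r(f)`. Named fact, not proved
here. [cite: BoubakriGreuelMarkwig2010, Prop. 4.16] -/
def Prop416 : Prop :=
  ∀ (K : Type) [Field K] [IsAlgClosed K] (f : MvPowerSeries (Fin 2) K), f ≠ 0 →
    f ∈ maximalIdeal (MvPowerSeries (Fin 2) K) →
      numBranches f ≤ rN f ∧
        newtonNumber f + (rN f : ℕ∞) ≤ milnorNumberENat f + (numBranches f : ℕ∞)

/-- [GreuelNguyen2010] **Theorem 3.12**: for REDUCED `f ∈ K[[x,y]]` (`K` algebraically closed, any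
characteristic), `δ(f) = δ_N(f)` if and only if `f` is WHNND. Named fact, not proved here.
[cite: GreuelNguyen2010, Thm. 3.12] -/
def GNThm312 : Prop :=
  ∀ (K : Type) [Field K] [IsAlgClosed K] (f : MvPowerSeries (Fin 2) K), f ≠ 0 →
    f ∈ maximalIdeal (MvPowerSeries (Fin 2) K) → Squarefree f →
      (deltaInvariant f = deltaN f ↔ IsWHNND f)

/-- [GarciaBarrosoPloski2022] **Theorem 3.1** (`K` algebraically closed of characteristic `p ≥ 0`,
`f ∈ K[[x,y]]` a REDUCED power series defining an algebroid curve; `μ̄(f) := 2δ(f) − r(f) + 1`, `r(f)` the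
number of irreducible components; `μ(N_f)` = the Newton number (their (3)/(4) = `newtonNumber`);
`r(N_f) = Σ_S r(S) + k + l` = `rN`; "`f` is non-degenerate if `in(f,S)~` is reduced for every edge `S`",
equivalently (their Remark 2.1, [GreuelNguyen2010] Prop. 3.5) the system
`∂ₓ in(f,S) = ∂_y in(f,S) = in(f,S) = 0` has no solution off `{xy = 0}`, i.e. `IsWeaklyNewtonNondegenerate`):
(1) `μ̄(f) − μ(N_f) ≥ r(N_f) − r(f) ≥ 0`; (2) if `f` is non-degenerate then `μ̄(f) = μ(N_f)` and
`r(N_f) = r(f)`. Rendered in `ℕ ∪ {∞}` without subtraction. Named fact, not proved here ((1) is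
[BoubakriGreuelMarkwig2010] Prop. 4.16 combined with Prop. 4.14 and Thm. 3.3).
[cite: GarciaBarrosoPloski2022, Thm. 3.1] -/
def GBPThm31 : Prop :=
  ∀ (K : Type) [Field K] [IsAlgClosed K] (f : MvPowerSeries (Fin 2) K), f ≠ 0 →
    f ∈ maximalIdeal (MvPowerSeries (Fin 2) K) → Squarefree f →
      (numBranches f ≤ rN f ∧ newtonNumber f + (rN f : ℕ∞) ≤ 2 * deltaInvariant f + 1) ∧
      (IsWeaklyNewtonNondegenerate f →
        2 * deltaInvariant f + 1 = newtonNumber f + (numBranches f : ℕ∞) ∧ rN f = numBranches f)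

/-- [BoubakriGreuelMarkwig2010] **Example 4.6** (a reduced planar `f` that is not INND w.r.t. any
`C`-polytope): `char K = 2`, `f = x⁶ + y³ + x⁵y`; "Note that `μ(f) = 13 > 10 = μ_N(f)`". The two values
are the paper's computation, recorded as a named fact. [cite: BoubakriGreuelMarkwig2010, Ex. 4.6] -/
def Ex46 : Prop :=
  ∀ (K : Type) [Field K] [IsAlgClosed K] [CharP K 2],
    let f : MvPowerSeries (Fin 2) K :=
      MvPowerSeries.X 0 ^ 6 + MvPowerSeries.X 1 ^ 3 + MvPowerSeries.X 0 ^ 5 * MvPowerSeries.X 1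
    IsIsolated f ∧ milnorNumber f = 13 ∧ newtonNumber f = 10

/-- [GreuelNguyen2010] **Example 2.1**: `char K = 3`, `f = x³ + xy + y³`: "`μ(f) = μ_N(f) = 1` but `f` is
not NND" (Kouchnirenko's condition is sufficient, not necessary). Named fact (the paper's computation).
[cite: GreuelNguyen2010, Ex. 2.1] -/
def GNEx21 : Prop :=
  ∀ (K : Type) [Field K] [IsAlgClosed K] [CharP K 3],
    let f : MvPowerSeries (Fin 2) K :=
      MvPowerSeries.X 0 ^ 3 + MvPowerSeries.X 0 * MvPowerSeries.X 1 + MvPowerSeries.X 1 ^ 3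
    IsIsolated f ∧ milnorNumber f = 1 ∧ newtonNumber f = 1 ∧ ¬ IsNewtonNondegenerate f

end BoubakriGreuelMarkwig

end Literature.AlgebraicGeometry.Resolution

end
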